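import Summits.NavierStokesRegularity.NavierStokesRegularity.Theses.AdaptedFrequency
import Literature.Analysis.FluidPDE.AdaptedBackwardKernel
import Literature.Analysis.FluidPDE.NSQuasipotential

/-!
# `AdaptedKernelExists` (stmt-NavierStokesRegularity-2956): the sign of the viscosity is load-bearing

Negative (support) lemmas for the crux `AdaptedFrequency.AdaptedKernelExists`, extracted from the
crux work file `Cruxes/AdaptedKernelExists/Disproof.lean` (cdisprove seat, cycle 1):

* the four solution hypotheses of the crux are satisfiable at EVERY viscosity by the zero flow
  (`hypotheses_zero`) — the crux is not vacuous, and for `ν > 0` the zero flow passes it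
  (`conclusion_zero`, the backward heat kernel of the Literature file);
* the crux with `0 < ν` weakened to `0 ≤ ν` is FALSE (`adaptedKernelExists_false_without_viscosityPos`):
  at `ν = 0` an adapted kernel of the zero flow is frozen in time at every point
  (`adapted_zero_viscosity_const`), contradicting the lower Gaussian bound at the pole.

So any proof of the crux must use `ν > 0` (in the lines: the normalisation `σ = ν(T - t)` of every
block estimate). [folklore]
-/

noncomputable section

namespace Summit.NavierStokesRegularity.NavierStokesRegularity.Theorems.AdaptedKernelExistsNegative


open Set Filter Topology MeasureTheory Function
open Literature.Analysis.FluidPDE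

local notation "ℝ³" => EuclideanSpace ℝ (Fin 3)

/-- The zero datum decays rapidly. [folklore] -/
theorem hasRapidSpatialDecay_zero : HasRapidSpatialDecay (0 : ℝ³ → ℝ³) := fun n K =>
  ⟨0, fun x => by
    have : iteratedFDeriv ℝ n (0 : ℝ³ → ℝ³) x = 0 := by
      rw [Pi.zero_def, iteratedFDeriv_fun_zero]; rfl
    rw [this, norm_zero, mul_zero]⟩

/-- The zero flow has the Type-I rate at every `T` (constant `0`): `IsTypeIBlowup` is an upper
bound only. [folklore] -/
theorem isTypeIBlowup_zero (T : ℝ) : IsTypeIBlowup (0 : ℝ → ℝ³ → ℝ³) T :=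
  ⟨0, Eventually.of_forall fun t x => by simp⟩

/-- **Non-vacuity of the hypotheses at every viscosity**: `u ≡ 0`, `p ≡ 0` on `[0, T)` is
classical, Leray–Hopf from the (rapidly decaying) zero datum, and Type-I. [folklore] -/
theorem hypotheses_zero (ν T : ℝ) :
    IsClassicalNSSolutionOn (Ico 0 T) ν 0 (0 : ℝ → ℝ³ → ℝ³) 0 ∧
      IsLerayHopfOn T ν 0 ((0 : ℝ → ℝ³ → ℝ³) 0) 0 ∧
      HasRapidSpatialDecay ((0 : ℝ → ℝ³ → ℝ³) 0) ∧ IsTypeIBlowup (0 : ℝ → ℝ³ → ℝ³) T :=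
  ⟨isClassicalNSSolutionOn_zero _ _, by simpa using isLerayHopfOn_zero (E := ℝ³) T ν,
    by simpa using hasRapidSpatialDecay_zero, isTypeIBlowup_zero T⟩

/-- **The zero flow passes the crux** for `ν > 0`: the backward heat kernel with pole `(T, x₀)` is
an adapted, Gaussian-comparable kernel on `[0, T)` (Literature, proved). [folklore] -/
theorem conclusion_zero {ν : ℝ} (hν : 0 < ν) {T : ℝ} (hT : 0 < T) (x₀ : ℝ³) :
    ∃ t₀ ∈ Ico 0 T, ∃ G : ℝ → ℝ³ → ℝ,
      IsAdaptedBackwardKernel ν (0 : ℝ → ℝ³ → ℝ³) (Ico t₀ T) T x₀ G ∧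
        IsGaussianComparable G (Ico t₀ T) T x₀ := by
  refine ⟨0, ⟨le_rfl, hT⟩, backwardHeatKernel ν T x₀,
    isAdaptedBackwardKernel_backwardHeatKernel_Ico hν 0 T x₀, ?_⟩
  obtain ⟨c₁, c₂, C₁, C₂, h₁, h₂, h₃, h₄, h⟩ := isGaussianComparable_backwardHeatKernel (E := ℝ³) hν T x₀
  exact ⟨c₁, c₂, C₁, C₂, h₁, h₂, h₃, h₄, fun t ht x => h t (show t < T from ht.2) x⟩

/-- At `ν = 0` an adapted kernel of the zero flow on a convex time set is constant in time at every
point (`∂ₜG = 0` and `C²`). [folklore] -/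
theorem adapted_zero_viscosity_const {S : Set ℝ} (hS : Convex ℝ S) {T : ℝ} {x₀ : ℝ³}
    {G : ℝ → ℝ³ → ℝ} (hK : IsAdaptedBackwardKernel 0 (0 : ℝ → ℝ³ → ℝ³) S T x₀ G)
    {s t : ℝ} (hs : s ∈ S) (ht : t ∈ S) (x : ℝ³) : G t x = G s x := by
  have hdiff : DifferentiableOn ℝ (fun r => G r x) S := fun r hr =>
    hK.differentiableWithinAt_time hr x
  have hderiv : ∀ r ∈ S, fderivWithin ℝ (fun r => G r x) S r = 0 := by
    intro r hr
    have h1 := hK.adjoint_eq r hr x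
    simp only [Pi.zero_apply, map_zero, add_zero, zero_mul, timeDerivWithin_apply] at h1
    ext
    simpa [derivWithin] using h1
  exact hS.is_const_of_fderivWithin_eq_zero hdiff hderiv ht hs

/-- **LOAD-BEARING (`0 < ν`).** `AdaptedKernelExists` with the hypothesis `0 < ν` weakened to
`0 ≤ ν` (everything else verbatim) is FALSE: at `ν = 0`, `T = 1`, for the zero flow and the pole
`x₀ = 0`, any candidate kernel is frozen in time at the pole while the lower Gaussian bound
`c₁ (1 - t)^{-3/2}` is unbounded as `t ↑ 1`. [folklore] -/
theorem adaptedKernelExists_false_without_viscosityPos :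
    ¬ (∀ (ν T : ℝ), 0 ≤ ν → 0 < T → ∀ (u : ℝ → EuclideanSpace ℝ (Fin 3) → EuclideanSpace ℝ (Fin 3)) (p : ℝ → EuclideanSpace ℝ (Fin 3) → ℝ), Literature.Analysis.FluidPDE.IsClassicalNSSolutionOn (Set.Ico 0 T) ν 0 u p → Literature.Analysis.FluidPDE.IsLerayHopfOn T ν 0 (u 0) u → Literature.Analysis.FluidPDE.HasRapidSpatialDecay (u 0) → Literature.Analysis.FluidPDE.IsTypeIBlowup u T → ∀ x₀ : EuclideanSpace ℝ (Fin 3), ∃ t₀ ∈ Set.Ico 0 T, ∃ G : ℝ → EuclideanSpace ℝ (Fin 3) → ℝ, (ContDiffOn ℝ 2 (Function.uncurry G) (Set.Ico t₀ T ×ˢ Set.univ) ∧ (∀ t ∈ Set.Ico t₀ T, ∀ x, 0 < G t x) ∧ (∀ t ∈ Set.Ico t₀ T, ∀ x, Literature.Analysis.FluidPDE.timeDerivWithin (Set.Ico t₀ T) G t x + fderiv ℝ (G t) x (u t x) + ν * Laplacian.laplacian (G t) x = 0) ∧ (∀ t ∈ Set.Ico t₀ T, ∫ x, G t x = 1) ∧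 (∀ φ : EuclideanSpace ℝ (Fin 3) → ℝ, Continuous φ → (∃ M : ℝ, ∀ x, |φ x| ≤ M) → Filter.Tendsto (fun t => ∫ x, φ x * G t x) (nhdsWithin T (Set.Iio T)) (nhds (φ x₀)))) ∧ (∃ c₁ c₂ C₁ C₂ : ℝ, 0 < c₁ ∧ 0 < c₂ ∧ 0 < C₁ ∧ 0 < C₂ ∧ ∀ t ∈ Set.Ico t₀ T, ∀ x, c₁ * (T - t) ^ (-(3:ℝ) / 2) * Real.exp (-(‖x - x₀‖ ^ 2) / (c₂ * (T - t))) ≤ G t x ∧ G t x ≤ C₁ * (T - t) ^ (-(3:ℝ) / 2) * Real.exp (-(‖x - x₀‖ ^ 2) / (C₂ * (T - t))))) := by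
  intro h
  obtain ⟨hcl, hLH, hdec, hTI⟩ := hypotheses_zero (0 : ℝ) 1
  obtain ⟨t₀, ht₀, G, hfive, c₁, c₂, C₁, C₂, hc₁, _hc₂, _hC₁, _hC₂, hcomp⟩ :=
    h 0 1 le_rfl one_pos 0 0 hcl hLH hdec hTI 0
  have hK : IsAdaptedBackwardKernel 0 (0 : ℝ → ℝ³ → ℝ³) (Ico t₀ 1) 1 0 G :=
    isAdaptedBackwardKernel_iff.2 hfive
  -- the candidate is frozen in time at the pole
  set g₀ : ℝ := G t₀ 0 with hg₀
  have hg₀pos : 0 < g₀ := hK.pos t₀ ⟨le_rfl, ht₀.2⟩ 0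
  -- evaluate the lower bound at `x = x₀ = 0`, `t = 1 - δ`
  set δ : ℝ := min ((1 - t₀) / 2) (c₁ / (2 * g₀)) with hδ
  have hδpos : 0 < δ := lt_min (by linarith [ht₀.2]) (by positivity)
  have hδle : δ ≤ (1 - t₀) / 2 := min_le_left _ _
  have hδle' : δ ≤ c₁ / (2 * g₀) := min_le_right _ _
  have hδone : δ ≤ 1 := by linarith [ht₀.1]
  have hmem : 1 - δ ∈ Ico t₀ 1 := ⟨by linarith, by linarith⟩
  have hlow := (hcomp (1 - δ) hmem 0).1
  rw [adapted_zero_viscosity_const (convex_Ico t₀ 1) hK ⟨le_rfl, ht₀.2⟩ hmem 0] at hlow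
  have hsimp : (1 : ℝ) - (1 - δ) = δ := by ring
  simp only [sub_zero, norm_zero, ne_eq, OfNat.ofNat_ne_zero, not_false_eq_true, zero_pow,
    neg_zero, zero_div, Real.exp_zero, mul_one, hsimp] at hlow
  -- `hlow : c₁ * δ ^ (-3/2) ≤ g₀`; compare with `δ ^ (-1)` since `δ ≤ 1`
  have hpow : δ ^ (-1 : ℝ) ≤ δ ^ (-(3 : ℝ) / 2) :=
    Real.rpow_le_rpow_of_exponent_ge hδpos hδone (by norm_num)
  rw [Real.rpow_neg_one] at hpow
  have h1 : c₁ * δ⁻¹ ≤ g₀ := le_trans (mul_le_mul_of_nonneg_left hpow hc₁.le) hlow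
  have h2 : c₁ ≤ g₀ * δ := by
    have := mul_le_mul_of_nonneg_right h1 hδpos.le
    rwa [mul_assoc, inv_mul_cancel₀ hδpos.ne', mul_one] at this
  have h3 : g₀ * δ ≤ c₁ / 2 := by
    calc g₀ * δ ≤ g₀ * (c₁ / (2 * g₀)) := mul_le_mul_of_nonneg_left hδle' hg₀pos.le
      _ = c₁ / 2 := by field_simp
  linarith

end Summit.NavierStokesRegularity.NavierStokesRegularity.Theorems.AdaptedKernelExistsNegative

end
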